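import Summits.Parity.GeneralizedHardyLittlewood.Theorems.PrimeLevelFamEdgeMomentsBeyondDiagonalDiagCornerAbelBVTwoVar
import Summits.Parity.GeneralizedHardyLittlewood.Theorems.PrimeLevelFamEdgeMomentsBeyondDiagonalDiagCornerAbelRayLog
import HarnessLib

/-!
# Route `PrimeLevelFamEdge`, crux K_A `MomentsBeyondDiagonal` (stmt-Parity-20007), line «petersson_layers» v4, stub `stub_diag`:
# **the two-variable Abel estimate for a `√`/`log`-controlled weight (the shape of the continued Bose remainders)**

Instantiation of `…DiagCornerAbelBVTwoVar.abs_doubleSum_bv_pow_le` (p820228) for a weight `r` with the four structural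
bounds delivered for the continued Bose remainders `r_ab` by `…DiagBoseMixedRemainderSqrt` (p820306) and
`…DiagBoseMixedTailRem` (p820374):
(S1) `|r(y)| ≤ C_s√y`, (S2) `|r(y₁)−r(y₂)| ≤ C_s(y₂−y₁)/√y₁` on `(0,1]`; (T1) `|r(y)| ≤ C_t(1+log y)^N`,
(T2) `|r(y₁)−r(y₂)| ≤ C_t(1+log y₂)^N(y₂−y₁)/y₁` on `[1,∞)`. With `Y₁ = 2αK₁Y ≤ 1`, `M = 2αY²`, `P = (1+|log M|)^N`:

* `abs_doubleSum_sqrt_log_weight_le` — **`|Σ_{k₁,k₂≤Y} a(k₁)a(k₂)ℓ⁺(k₁)ⁱℓ⁺(k₂)ʲ r(αk₁k₂)|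
  ≤ Sᵢ·B·logʲY·3C_s√Y₁ + Sⱼ·2η·logⁱY·(3(C_s + C_tP) + 2C_s + C_tP(1+|log M|))`** —
  K_B's `abs_doubleSum_cornerE_pow_le` with `E` replaced by any such `r` (rows `k₁ ≤ K₁` save `√Y₁`, rows `k₁ > K₁` save `η`).

Def-free; theorems only. Helper `--supports stmt-Parity-20007`; closes nothing; K_A, K_B and the Parity summit are NOT
proved; nothing about Landau–Siegel zeros.

## References
* E. Kowalski, P. Michel, J. VanderKam, J. reine angew. Math. 526 (2000), Prop. 5.1 p. 18.
  [cite: KowalskiMichelVanderKam2000, Prop. 5.1 — derivation (corner of the diagonal, general weights)]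
-/

noncomputable section

open Finset Real

namespace Summit.Parity.GeneralizedHardyLittlewood.Theorems.MomentsBeyondDiagonal.DiagCorner

open Summit.Parity.GeneralizedHardyLittlewood.Theorems.BeyondDiagonalBeatsQuarter.Corner

/-- **Two-variable Abel estimate for a `√`/`log`-controlled weight.**
[cite: KowalskiMichelVanderKam2000, Prop. 5.1 — derivation (corner of the diagonal, real-variable form, general weight)] -/
theorem abs_doubleSum_sqrt_log_weight_le {a : ℕ → ℝ} {r : ℝ → ℝ} {Y α B η Cs Ct : ℝ} {K₁ i j N : ℕ}
    (hY : 1 ≤ Y) (hα : 0 < α) (hi : 1 ≤ i) (hj : 1 ≤ j) (hCs : 0 ≤ Cs) (hCt : 0 ≤ Ct)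
    (hB : ∀ e : ℕ, |∑ k ∈ Icc 1 e, a k| ≤ B) (hη : ∀ e : ℕ, K₁ ≤ e → |∑ k ∈ Icc 1 e, a k| ≤ η)
    (hS1 : ∀ y : ℝ, 0 < y → y ≤ 1 → |r y| ≤ Cs * Real.sqrt y)
    (hS2 : ∀ y₁ y₂ : ℝ, 0 < y₁ → y₁ ≤ y₂ → y₂ ≤ 1 → |r y₁ - r y₂| ≤ Cs * (y₂ - y₁) / Real.sqrt y₁)
    (hT1 : ∀ y : ℝ, 1 ≤ y → |r y| ≤ Ct * (1 + Real.log y) ^ N)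
    (hT2 : ∀ y₁ y₂ : ℝ, 1 ≤ y₁ → y₁ ≤ y₂ → |r y₁ - r y₂| ≤ Ct * (1 + Real.log y₂) ^ N * (y₂ - y₁) / y₁)
    (hY₁ : 2 * α * K₁ * Y ≤ 1) :
    |∑ k₁ ∈ Icc 1 ⌊Y⌋₊, ∑ k₂ ∈ Icc 1 ⌊Y⌋₊,
        a k₁ * a k₂ * ellp Y k₁ ^ i * ellp Y k₂ ^ j * r (α * k₁ * k₂)| ≤
      (∑ k ∈ Icc 1 ⌊Y⌋₊, |a k| * ellp Y k ^ i) *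
          (B * (Real.log Y ^ j * (3 * Cs * Real.sqrt (2 * α * K₁ * Y)))) +
        (∑ k ∈ Icc 1 ⌊Y⌋₊, |a k| * ellp Y k ^ j) * ((2 * η) * (Real.log Y ^ i *
          (3 * (Cs + Ct * (1 + |Real.log (2 * α * Y ^ 2)|) ^ N) + 2 * Cs +
            Ct * (1 + |Real.log (2 * α * Y ^ 2)|) ^ N * (1 + |Real.log (2 * α * Y ^ 2)|)))) := by
  have hY0 : 0 < Y := by linarith
  set Y₁ : ℝ := 2 * α * K₁ * Y with hY₁def
  set M : ℝ := 2 * α * Y ^ 2 with hM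
  have hM0 : 0 < M := by positivity
  set P : ℝ := (1 + |Real.log M|) ^ N with hP
  have hP1 : 1 ≤ P := one_le_pow₀ (by linarith [abs_nonneg (Real.log M)])
  set G : ℝ := Cs + Ct * P with hG
  have hG0 : 0 ≤ G := by positivity
  set K : ℝ := Ct * P with hK
  have hK0 : 0 ≤ K := by positivity
  have hY₁0 : 0 ≤ Y₁ := by positivity
  -- (G): size on `(0, M]`
  have hGbd : ∀ y : ℝ, 0 < y → y ≤ M → |r y| ≤ G := by
    intro y hy hyM
    rcases le_or_gt y 1 with hy1 | hy1
    · have h := hS1 y hy hy1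
      have : Real.sqrt y ≤ 1 := Real.sqrt_le_one.2 hy1
      calc |r y| ≤ Cs * Real.sqrt y := h
        _ ≤ Cs * 1 := by gcongr
        _ ≤ G := by rw [hG, mul_one]; linarith [mul_nonneg hCt (zero_le_one.trans hP1)]
    · have h := hT1 y hy1.le
      have hlog : Real.log y ≤ |Real.log M| := (Real.log_le_log hy hyM).trans (le_abs_self _)
      have hly : 0 ≤ Real.log y := Real.log_nonneg hy1.le
      calc |r y| ≤ Ct * (1 + Real.log y) ^ N := h
        _ ≤ Ct * P := by rw [hP]; gcongr
        _ ≤ G := by rw [hG]; linarith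
  -- (T2'): `1/y`-Lipschitz with constant `K` on `[1, M]`
  have hT2' : ∀ y₁ y₂ : ℝ, 1 ≤ y₁ → y₁ ≤ y₂ → y₂ ≤ M → |r y₁ - r y₂| ≤ K * (y₂ - y₁) / y₁ := by
    intro y₁ y₂ hy₁ h12 hy₂M
    have h := hT2 y₁ y₂ hy₁ h12
    have hy₁0 : 0 < y₁ := one_pos.trans_le hy₁
    have hlog : Real.log y₂ ≤ |Real.log M| := (Real.log_le_log (by linarith) hy₂M).trans (le_abs_self _)
    have hl2 : 0 ≤ Real.log y₂ := Real.log_nonneg (hy₁.trans h12)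
    calc |r y₁ - r y₂| ≤ Ct * (1 + Real.log y₂) ^ N * (y₂ - y₁) / y₁ := h
      _ ≤ Ct * P * (y₂ - y₁) / y₁ := by
          rw [hP]; gcongr
  -- the hypotheses of the abstract estimate
  have hr1 : ∀ y : ℝ, 0 < y → y ≤ 2 * α * K₁ * Y → |r y| ≤ Cs * Real.sqrt Y₁ := by
    intro y hy hyY
    have hy1 : y ≤ 1 := hyY.trans hY₁
    calc |r y| ≤ Cs * Real.sqrt y := hS1 y hy hy1
      _ ≤ Cs * Real.sqrt Y₁ := by gcongr
  have hv1 : ∀ c : ℝ, 0 < c → ∀ w : ℕ, c * ((w : ℝ) + 1) ≤ 2 * α * K₁ * Y →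
      ∑ e ∈ Ioc 0 w, |r (c * ((e : ℝ) + 1)) - r (c * e)| ≤ 2 * Cs * Real.sqrt Y₁ := by
    intro c hc w hcw
    have h := sum_abs_sub_le_of_lipschitz_sqrt (r := r) (C := Cs) hc hS2 (Nat.zero_le w) (hcw.trans hY₁)
    calc _ ≤ 2 * Cs * Real.sqrt (c * ((w : ℝ) + 1)) := h
      _ ≤ 2 * Cs * Real.sqrt Y₁ := by gcongr
  have hrG : ∀ y : ℝ, 0 < y → y ≤ 2 * α * Y ^ 2 → |r y| ≤ G := fun y hy hyM ↦ hGbd y hy hyM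
  have hvG : ∀ c : ℝ, 0 < c → ∀ u w : ℕ, u ≤ w → c * ((w : ℝ) + 1) ≤ 2 * α * Y ^ 2 →
      ∑ e ∈ Ioc u w, |r (c * ((e : ℝ) + 1)) - r (c * e)| ≤ 2 * Cs + 2 * G + K * (1 + |Real.log M|) :=
    fun c hc u w huw hcw ↦ sum_abs_sub_ray_le_log (r := r) hc hK0 hS2 hT2' hGbd huw hcw
  have hmain := abs_doubleSum_bv_pow_le (a := a) (r := r) (K₁ := K₁) hY hα hi hj hB hη
    (by positivity) (by positivity) hr1 hv1 hrG hvG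
  -- rewrite the constants
  have hHV : Cs * Real.sqrt Y₁ + 2 * Cs * Real.sqrt Y₁ = 3 * Cs * Real.sqrt (2 * α * K₁ * Y) := by rw [hY₁def]; ring
  have hGV : G + (2 * Cs + 2 * G + K * (1 + |Real.log M|)) =
      3 * (Cs + Ct * (1 + |Real.log (2 * α * Y ^ 2)|) ^ N) + 2 * Cs +
        Ct * (1 + |Real.log (2 * α * Y ^ 2)|) ^ N * (1 + |Real.log (2 * α * Y ^ 2)|) := by
    simp only [hG, hK, hP, hM]; ring
  rw [hHV, hGV] at hmain
  exact hmain

end Summit.Parity.GeneralizedHardyLittlewood.Theorems.MomentsBeyondDiagonal.DiagCorner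

end
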